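import Summits.Schanuel.Schanuel.Theorems.ZilberEacRealSplitLevel
import Summits.Schanuel.Schanuel.Theorems.ZilberEacRealSplitCore
import HarnessLib

/-!
# Totally real hyperplane × graph curve (3/3): exponential points

Zilber's Exponential-Algebraic Closedness, case ladder (host summit Schanuel, cell `pub-schanuel`,
seat 2, gen 7).  Third of three files.

**THEOREM (`exists_expPoint_realSplit`).**  Let `s ≥ 1`, `r ∈ ℝˢ` with some `r_{j₀}` irrational,
`c ∈ ℂ`, and nonzero `qⱼ ∈ ℂ[u]` (`j < s`) with `Σⱼ rⱼ deg qⱼ ≠ 1`.  Then the system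
`e^{xⱼ} = qⱼ(e^{Σᵢ rᵢ xᵢ + c})` (`j < s`) has a solution `x ∈ ℂˢ`; equivalently the `(s+1)`-fold
`W = {x_{s+1} = Σⱼ rⱼ xⱼ + c, yⱼ = qⱼ(y_{s+1})} ⊆ ℂ^{s+1} × ℂ^{s+1}` — the product of a totally real
affine hyperplane with the graph curve `u ↦ (q₁(u), …, q_s(u), u)` — meets the graph of `exp`
(`realSplit_inter_expGraph_nonempty`, in the dictionary of `EACGraphFibres.graphFibreVariety`).

For `s = 2` these are members of the first open cell `EC(3,2)` (base the hyperplane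
`x₃ = r₁ x₁ + r₂ x₂ + c`: in the APERIODIC piece when `1, r₁, r₂` are `ℚ`-linearly independent,
`EACAperiodicBase.hasIntegerPeriod_graphBase_linear_iff`, in the periodic piece otherwise), at the
purely oscillatory end `λ = Σ rⱼ deg Aⱼ = 0` of `ZilberEacComplexRealHyperplane` (whose theorem needs
`λ < 0`, i.e. fibres moving with `x'`): e.g. `e^{z} = e^{√2 z + √3 w} + 1`,
`e^{w} = (e^{√2 z + √3 w})² - 2` (`sqrt_two_sqrt_three_split_system_solvable`).  For `s = 1` it is
the existence half of `ZilberEacRealLineDensity`.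

**HONEST FRAMING.** Existence of exponential points on split varieties `L × W` with `L` linear is
IN PRINT: Gallinaro, Selecta Math. 29 (2023) Thm 8.8 (tree fact `gallinaro2023_thm_8_8`, via
tropical geometry and Khovanskii–Kirby–Zilber), for all `n`; what is new here is an unconditional
kernel proof for this explicit slice by a different, elementary-analytic method (harmonic level
set + open mapping theorem + Kronecker: `ZilberEacRealSplitLevel`, `ZilberEacRealSplitCore`), which
moreover produces exponential points whose fibre coordinate accumulates on arcs (the input for
Zariski density, proved for `s = 1` in `ZilberEacRealLineDensity`).  Nothing here bears on
Schanuel's conjecture (EAC ⇏ SC); `ECCell 3 2` and its pieces stay OPEN.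
-/

noncomputable section

open MvPolynomial Filter Topology Complex Metric
open Literature.NumberTheory.Transcendental Literature.ModelTheory.Zilber
  Literature.ModelTheory.ExponentialFields

set_option linter.dupNamespace false

namespace Summit.Schanuel.Schanuel.Theorems

section RealSplit

variable {s : ℕ}

/-- **THEOREM (totally real hyperplane × graph curve).** `r_{j₀}` irrational, all `qⱼ ≠ 0`,
`Σⱼ rⱼ deg qⱼ ≠ 1` ⟹ `∃ x ∈ ℂˢ, e^{xⱼ} = qⱼ(e^{Σᵢ rᵢ xᵢ + c})` for all `j`.  Proof: a level point
(`exists_splitLevelPoint`), the analytic core (`realSplit_core`), and any one of the exponential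
points it produces. -/
theorem exists_expPoint_realSplit (r : Fin s → ℝ) {j₀ : Fin s} (hj₀ : Irrational (r j₀)) (c : ℂ)
    {q : Fin s → Polynomial ℂ} (hq : ∀ j, q j ≠ 0)
    (hdeg : ∑ j, r j * ((q j).natDegree : ℝ) ≠ 1) :
    ∃ x : Fin s → ℂ, ∀ j, exp (x j) = (q j).eval (exp (∑ i, (r i : ℂ) * x i + c)) := by
  obtain ⟨u₀, hu₀, hqu₀, hlev⟩ := exists_splitLevelPoint r c hq hdeg
  obtain ⟨A, hA, hAcc⟩ := realSplit_core r hj₀ c hdeg hu₀ hqu₀ hlev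
  obtain ⟨α, hα⟩ := hA.nonempty
  obtain ⟨x, w, -, -, hxw⟩ := hAcc α hα
  refine ⟨x 0, fun j => ?_⟩
  rw [(hxw 0).2]
  exact (hxw 0).1 j

/-- **EC vocabulary.** The `(s+1)`-fold `W = {x_{s+1} = Σⱼ rⱼ xⱼ + c, yⱼ = qⱼ(y_{s+1})}`, written as
the graph-fibre variety `W(Σ rⱼ Xⱼ + c; qⱼ(u))` of `EACGraphFibres`, meets the graph of `exp`
(`r_{j₀}` irrational, `qⱼ ≠ 0`, `Σⱼ rⱼ deg qⱼ ≠ 1`). -/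
theorem realSplit_inter_expGraph_nonempty (r : Fin s → ℝ) {j₀ : Fin s} (hj₀ : Irrational (r j₀))
    (c : ℂ) {q : Fin s → Polynomial ℂ} (hq : ∀ j, q j ≠ 0)
    (hdeg : ∑ j, r j * ((q j).natDegree : ℝ) ≠ 1) :
    (graphFibreVariety (∑ j, C (r j : ℂ) * X j + C c)
        (fun j => Polynomial.aeval (X 0 : MvPolynomial (Fin (s + 1)) ℂ) (q j)) ∩
      expGraph ℂ (s + 1)).Nonempty := by
  rw [graphFibreVariety_inter_expGraph_nonempty_iff]
  obtain ⟨x, hx⟩ := exists_expPoint_realSplit r hj₀ c hq hdeg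
  refine ⟨x, fun j => ?_⟩
  rw [eval_polynomial_aeval_X, Fin.cons_zero, hx j]
  congr 2
  simp

/-- **Membership dictionary** for the graph-fibre presentation: a point lies on
`W(Σ rⱼ Xⱼ + c; qⱼ(u))` iff `x_{s+1} = Σⱼ rⱼ xⱼ + c` and `yⱼ = qⱼ(y_{s+1})` for all `j`. -/
theorem mem_realSplit_iff (r : Fin s → ℝ) (c : ℂ) (q : Fin s → Polynomial ℂ)
    (z : Fin (s + 1) ⊕ Fin (s + 1) → ℂ) :
    z ∈ graphFibreVariety (∑ j, C (r j : ℂ) * X j + C c)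
        (fun j => Polynomial.aeval (X 0 : MvPolynomial (Fin (s + 1)) ℂ) (q j)) ↔
      z (Sum.inl (Fin.last s)) = ∑ j, (r j : ℂ) * z (Sum.inl (Fin.castSucc j)) + c ∧
        ∀ j : Fin s, z (Sum.inr (Fin.castSucc j)) = (q j).eval (z (Sum.inr (Fin.last s))) := by
  rw [mem_graphFibreVariety_iff]
  simp only [eval_polynomial_aeval_X, Fin.cons_zero, map_add, map_sum, map_mul, eval_C, eval_X]

/-- **The first open cell, purely oscillatory end: an explicit member of `EC(3,2)` with a solved
system.** `∃ z w ∈ ℂ, e^{z} = e^{√2 z + √3 w} + 1 ∧ e^{w} = (e^{√2 z + √3 w})² - 2` — the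
exponential points of `{x₃ = √2 x₁ + √3 x₂, y₁ = y₃ + 1, y₂ = y₃² - 2} ⊆ ℂ³ × ℂ³` (base an
aperiodic real plane, constant graph-curve fibre; `λ = 0`, outside `exists_expPoint_realHyperplane`). -/
theorem sqrt_two_sqrt_three_split_system_solvable :
    ∃ z w : ℂ, exp z = exp ((Real.sqrt 2 : ℂ) * z + (Real.sqrt 3 : ℂ) * w) + 1 ∧
      exp w = exp ((Real.sqrt 2 : ℂ) * z + (Real.sqrt 3 : ℂ) * w) ^ 2 - 2 := by
  have hq : ∀ j : Fin 2, (![Polynomial.X + Polynomial.C 1, Polynomial.X ^ 2 - Polynomial.C 2] j :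
      Polynomial ℂ) ≠ 0 := by
    intro j
    fin_cases j
    · intro h
      have := congrArg (Polynomial.eval (0 : ℂ)) h
      norm_num at this
    · intro h
      have := congrArg (Polynomial.eval (0 : ℂ)) h
      norm_num at this
  have hdeg : ∑ j : Fin 2, ![Real.sqrt 2, Real.sqrt 3] j *
      (((![Polynomial.X + Polynomial.C 1, Polynomial.X ^ 2 - Polynomial.C 2] j :
        Polynomial ℂ)).natDegree : ℝ) ≠ 1 := by
    have h1 : (Polynomial.X + Polynomial.C (1 : ℂ)).natDegree = 1 := Polynomial.natDegree_X_add_C 1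
    have h2 : (Polynomial.X ^ 2 - Polynomial.C (2 : ℂ)).natDegree = 2 := by
      rw [sub_eq_add_neg, ← Polynomial.C_neg, Polynomial.natDegree_X_pow_add_C]
    rw [Fin.sum_univ_two]
    simp only [Matrix.cons_val_zero, Matrix.cons_val_one, h1, h2,
      Nat.cast_one, mul_one, Nat.cast_ofNat]
    have h3 : (1 : ℝ) < Real.sqrt 3 := by
      rw [show (1 : ℝ) = Real.sqrt 1 by simp]
      exact Real.sqrt_lt_sqrt (by norm_num) (by norm_num)
    nlinarith [Real.sqrt_nonneg 2]
  obtain ⟨x, hx⟩ := exists_expPoint_realSplit ![Real.sqrt 2, Real.sqrt 3] (j₀ := 0)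
    (by simpa using irrational_sqrt_two) 0 hq hdeg
  refine ⟨x 0, x 1, ?_, ?_⟩
  · have := hx 0
    simpa [Fin.sum_univ_two] using this
  · have := hx 1
    simpa [Fin.sum_univ_two] using this

/-- **A member of the PERIODIC piece of `EC(3,2)`** (base `x₃ = √2 x₁ + √2 x₂`, period
`(1,-1,0)`, additively free): `∃ z w, e^{z} = e^{√2 z + √2 w} - 3 ∧ e^{w} = e^{√2 z + √2 w} + 5`. -/
theorem sqrt_two_periodic_split_system_solvable :
    ∃ z w : ℂ, exp z = exp ((Real.sqrt 2 : ℂ) * z + (Real.sqrt 2 : ℂ) * w) - 3 ∧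
      exp w = exp ((Real.sqrt 2 : ℂ) * z + (Real.sqrt 2 : ℂ) * w) + 5 := by
  have hq : ∀ j : Fin 2, (![Polynomial.X - Polynomial.C 3, Polynomial.X + Polynomial.C 5] j :
      Polynomial ℂ) ≠ 0 := by
    intro j
    fin_cases j
    · exact Polynomial.X_sub_C_ne_zero 3
    · intro h
      have := congrArg (Polynomial.eval (0 : ℂ)) h
      norm_num at this
  have hdeg : ∑ j : Fin 2, ![Real.sqrt 2, Real.sqrt 2] j *
      (((![Polynomial.X - Polynomial.C 3, Polynomial.X + Polynomial.C 5] j :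
        Polynomial ℂ)).natDegree : ℝ) ≠ 1 := by
    have h1 : (Polynomial.X - Polynomial.C (3 : ℂ)).natDegree = 1 := Polynomial.natDegree_X_sub_C 3
    have h2 : (Polynomial.X + Polynomial.C (5 : ℂ)).natDegree = 1 := Polynomial.natDegree_X_add_C 5
    rw [Fin.sum_univ_two]
    simp only [Matrix.cons_val_zero, Matrix.cons_val_one, h1, h2, Nat.cast_one, mul_one]
    intro h
    have h4 : Real.sqrt 2 = 1 / 2 := by linarith
    exact irrational_sqrt_two.ne_rational 1 2 (by rw [h4]; norm_num)
  obtain ⟨x, hx⟩ := exists_expPoint_realSplit ![Real.sqrt 2, Real.sqrt 2] (j₀ := 0)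
    (by simpa using irrational_sqrt_two) 0 hq hdeg
  refine ⟨x 0, x 1, ?_, ?_⟩
  · have := hx 0
    simpa [Fin.sum_univ_two] using this
  · have := hx 1
    simpa [Fin.sum_univ_two] using this

/-- The case `s = 1` recovers the existence half of `ZilberEacRealLineDensity`:
`e^{z} = q(e^{a z + b})` is solvable for real irrational `a` and `q ≠ 0` with `a · deg q ≠ 1`
(the last hypothesis is automatic there; here it is what the general theorem asks). -/
theorem exists_exp_eq_eval_exp_of_irrational' {a : ℝ} (ha : Irrational a) (b : ℂ)
    {q : Polynomial ℂ} (hq : q ≠ 0) (hdeg : a * (q.natDegree : ℝ) ≠ 1) :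
    ∃ z : ℂ, exp z = q.eval (exp ((a : ℂ) * z + b)) := by
  obtain ⟨x, hx⟩ := exists_expPoint_realSplit ![a] (j₀ := 0) (by simpa using ha) b
    (q := ![q]) (fun j => by fin_cases j; simpa using hq) (by simpa using hdeg)
  refine ⟨x 0, ?_⟩
  have := hx 0
  simpa using this

end RealSplit

end Summit.Schanuel.Schanuel.Theorems

end
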